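import Summits.HodgeConjecture.HodgeConjecture.Theorems.CyclicUnitaryPowersBlockScalars
import Literature.AlgebraicGeometry.Motives.EtaleTate

/-!
# Colour projectors on `T^{r,0}_K W`: slot operators, the coloured components of a tensor, and the
# action of the block scalars (centre of the deck-unitary group)

Helper for stub T `stub_unitaryTorusLemma` (and L `stub_deckUnitaryInvariantsMatching`) of the crux
`PowersHodgeOfDeckCommutators` (stmt-HodgeConjecture-19545, route `CyclicUnitaryPowers`, line `unitary-kunneth-fft`
v6, lane 2).  Over a field `K` of characteristic zero, for an endomorphism `σ` of `W` with `σ ^ p = 1` and a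
primitive `p`-th root `ζ` (spectral projectors `P_j = specProj σ ζ p j` of `CyclicUnitaryPowersSpectralProjectors`,
block scalars `Σ_j λ_j P_j` of `CyclicUnitaryPowersBlockScalars`):

* §1 `slotMap f = (⊗ᵢ f i) ⊗ id` on `T^{r,0}_K W = W^{⊗ r} ⊗ (W^∨)^{⊗ 0}` — multiplicative and MULTILINEAR in the
  family `f` (`slotMap_sum`, `slotMap_smul`, `slotMap_coord_zero`), and `tensorSpaceActOver γ = slotMap (fun _ => γ)`;
* §2 the colour projectors `colourProj c = slotMap (P_{c i})_i`, `c : Fin r → ℕ` a colouring of the slots: they sum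
  to `1` over the colourings with values `< p` and are pairwise orthogonal idempotents (`colourProj_mul`);
* §3 the block scalar `g_λ = Σ_j λ_j P_j` acts on `T^{r,0}` by `Σ_c (Π_i λ_{c i}) colourProj c`
  (`slotMap_blockScalar`); hence `g_λ` fixes a tensor `x` iff `(Π_i λ_{c i}) • x_c = x_c` for every coloured
  component `x_c = colourProj c x` (`smul_colourProj_eq_of_fixed`, `slotMap_blockScalar_eq_self_of_forall`);
* §4 an automorphism commuting with `σ` commutes with the colour projectors, so it fixes `x` iff it fixes
  every `x_c`;
* §5 colour counts `d_j(c) = #{i : c i = j}` and the elementary fact that a BALANCED colouring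
  (`d_j = d_{p-j}` for `0 < j < p`) kills every character `λ` of the centre (`λ_0 = 1`, `λ_j λ_{p-j} = 1`):
  `Π_i λ_{c i} = 1` (`prod_eq_one_of_balanced`).

Pure linear algebra; no Hodge theory.
-/

noncomputable section

open Module
open scoped TensorProduct PiTensorProduct BigOperators

namespace Summit.HodgeConjecture.HodgeConjecture.Theorems.CyclicUnitaryPowersColourProjectors

open Literature.AlgebraicGeometry.Motives
open Summit.HodgeConjecture.HodgeConjecture.Theorems.CyclicUnitaryPowersSpectralProjectors
open Summit.HodgeConjecture.HodgeConjecture.Theorems.CyclicUnitaryPowersBlockScalars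

variable {K : Type*} [Field K] {W : Type*} [AddCommGroup W] [Module K W] {r : ℕ}

/-! ### §1 Slot operators -/

/-- The slot operator `(⊗ᵢ f i) ⊗ id` on `T^{r,0}_K W`. [folklore] -/
def slotMap (f : Fin r → Module.End K W) : Module.End K (hodgeTensorSpaceOver K W r 0) :=
  TensorProduct.map (PiTensorProduct.map f) LinearMap.id

/-- `slotMap f` on a pure tensor. [folklore] -/
@[simp]
theorem slotMap_tprod_tmul (f : Fin r → Module.End K W) (w : Fin r → W) (y : ⨂[K]^0 (Module.Dual K W)) :
    slotMap f (PiTensorProduct.tprod K w ⊗ₜ[K] y) = (PiTensorProduct.tprod K fun i => f i (w i)) ⊗ₜ[K] y := by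
  simp [slotMap]

/-- `slotMap 1 = 1`. [folklore] -/
theorem slotMap_one : slotMap (fun _ : Fin r => (1 : Module.End K W)) = 1 := by
  rw [slotMap, PiTensorProduct.map_one, ← Module.End.one_eq_id]
  exact TensorProduct.map_one

/-- `slotMap` is multiplicative. [folklore] -/
theorem slotMap_mul (f g : Fin r → Module.End K W) : slotMap (f * g) = slotMap f * slotMap g := by
  change TensorProduct.map (PiTensorProduct.map fun i => f i * g i) LinearMap.id = _
  rw [PiTensorProduct.map_mul, slotMap, slotMap, ← TensorProduct.map_mul]
  rfl

variable (K W r) in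
/-- `slotMap` as a multilinear map of the family of slot endomorphisms. [folklore] -/
def slotMapMultilinear : MultilinearMap K (fun _ : Fin r => Module.End K W) (Module.End K (hodgeTensorSpaceOver K W r 0)) :=
  (LinearMap.rTensorHom (⨂[K]^0 (Module.Dual K W))).compMultilinearMap
    (PiTensorProduct.mapMultilinear K (fun _ : Fin r => W) (fun _ : Fin r => W))

/-- `slotMapMultilinear f = slotMap f`. [folklore] -/
@[simp]
theorem slotMapMultilinear_apply (f : Fin r → Module.End K W) : slotMapMultilinear K W r f = slotMap f := rfl

/-- **Multilinear expansion**: `slotMap (Σ_{j ∈ A i} g i j)_i = Σ_{c ∈ Π_i A i} slotMap (g i (c i))_i`. [folklore] -/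
theorem slotMap_sum {α : Type*} (A : Fin r → Finset α) (g : Fin r → α → Module.End K W) :
    slotMap (fun i => ∑ j ∈ A i, g i j) = ∑ c ∈ Fintype.piFinset A, slotMap (fun i => g i (c i)) := by
  have h := (slotMapMultilinear K W r).map_sum_finset g A
  simpa only [slotMapMultilinear_apply] using h

/-- `slotMap (a i • g i)_i = (Π_i a i) • slotMap g`. [folklore] -/
theorem slotMap_smul (a : Fin r → K) (g : Fin r → Module.End K W) :
    slotMap (fun i => a i • g i) = (∏ i, a i) • slotMap g := by
  have h := (slotMapMultilinear K W r).map_smul_univ a g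
  simpa only [slotMapMultilinear_apply] using h

/-- A slot operator with a zero slot vanishes. [folklore] -/
theorem slotMap_coord_zero {f : Fin r → Module.End K W} (i : Fin r) (hi : f i = 0) : slotMap f = 0 := by
  have h := (slotMapMultilinear K W r).map_coord_zero i hi
  simpa only [slotMapMultilinear_apply] using h

/-- On an empty index type `PiTensorProduct.map` is the identity. [folklore] -/
theorem piTensorProduct_map_fin_zero {M : Type*} [AddCommGroup M] [Module K M] (g : Fin 0 → (M →ₗ[K] M)) :
    PiTensorProduct.map g = LinearMap.id := by
  ext x
  simp only [LinearMap.compMultilinearMap_apply, PiTensorProduct.map_tprod, LinearMap.id_apply]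
  congr 1
  funext i
  exact Fin.elim0 i

/-- **On `T^{r,0}` the action of `γ ∈ GL(W)` is the slot operator `slotMap (fun _ => γ)`.** [folklore] -/
theorem coe_tensorSpaceActOver_eq_slotMap (γ : W ≃ₗ[K] W) :
    ((tensorSpaceActOver (a := r) (b := 0) γ : hodgeTensorSpaceOver K W r 0 ≃ₗ[K] hodgeTensorSpaceOver K W r 0) :
        hodgeTensorSpaceOver K W r 0 →ₗ[K] hodgeTensorSpaceOver K W r 0) = slotMap (fun _ => (γ : W →ₗ[K] W)) := by
  rw [coe_tensorSpaceActOver, piTensorProduct_map_fin_zero]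
  rfl

/-- Pointwise form of `coe_tensorSpaceActOver_eq_slotMap`. [folklore] -/
theorem tensorSpaceActOver_eq_slotMap_apply (γ : W ≃ₗ[K] W) (x : hodgeTensorSpaceOver K W r 0) :
    tensorSpaceActOver γ x = slotMap (fun _ => (γ : W →ₗ[K] W)) x := by
  rw [← coe_tensorSpaceActOver_eq_slotMap]
  rfl

/-! ### §2 Colour projectors -/

section Colour

variable (σ : W →ₗ[K] W) (ζ : K) (p : ℕ)

/-- The colour projector `⊗ᵢ P_{c i} ⊗ id` of a colouring `c : Fin r → ℕ` of the slots. [folklore] -/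
def colourProj (c : Fin r → ℕ) : Module.End K (hodgeTensorSpaceOver K W r 0) :=
  slotMap fun i => specProj σ ζ p (c i)

/-- Unfolding lemma. [folklore] -/
theorem colourProj_def (c : Fin r → ℕ) : colourProj σ ζ p c = slotMap (fun i => specProj σ ζ p (c i)) := rfl

variable {σ ζ p}

/-- Membership in the finite set of colourings with values `< p`. [folklore] -/
theorem mem_colourings_iff {c : Fin r → ℕ} :
    c ∈ Fintype.piFinset (fun _ : Fin r => Finset.range p) ↔ ∀ i, c i < p := by
  rw [Fintype.mem_piFinset]
  exact forall_congr' fun i => Finset.mem_range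

variable [CharZero K]

/-- **`Σ_c colourProj c = 1`** over the colourings with values `< p`. [folklore] -/
theorem sum_colourProj (hζ : IsPrimitiveRoot ζ p) (hp : 0 < p) :
    ∑ c ∈ Fintype.piFinset (fun _ : Fin r => Finset.range p), colourProj σ ζ p c = 1 := by
  have h := slotMap_sum (K := K) (W := W) (fun _ : Fin r => Finset.range p) (fun _ j => specProj σ ζ p j)
  simp only [sum_specProj hζ hp] at h
  rw [slotMap_one] at h
  simp only [colourProj_def]
  exact h.symm

/-- A tensor is the sum of its coloured components. [folklore] -/
theorem sum_colourProj_apply (hζ : IsPrimitiveRoot ζ p) (hp : 0 < p) (x : hodgeTensorSpaceOver K W r 0) :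
    ∑ c ∈ Fintype.piFinset (fun _ : Fin r => Finset.range p), colourProj σ ζ p c x = x := by
  rw [← LinearMap.sum_apply, sum_colourProj hζ hp, Module.End.one_apply]

/-- **The colour projectors are pairwise orthogonal idempotents.** [folklore] -/
theorem colourProj_mul (hσ : σ ^ p = 1) (hζ : IsPrimitiveRoot ζ p) (hp : 0 < p) {c c' : Fin r → ℕ}
    (hc : ∀ i, c i < p) (hc' : ∀ i, c' i < p) :
    colourProj σ ζ p c * colourProj σ ζ p c' = if c = c' then colourProj σ ζ p c else 0 := by
  rw [colourProj_def, colourProj_def, ← slotMap_mul]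
  split_ifs with h
  · subst h
    congr 1
    funext i
    exact (isIdempotentElem_specProj hσ hζ hp (c i)).eq
  · obtain ⟨i, hi⟩ : ∃ i, c i ≠ c' i := Function.ne_iff.mp h
    refine slotMap_coord_zero i ?_
    change specProj σ ζ p (c i) * specProj σ ζ p (c' i) = 0
    rw [Module.End.mul_eq_comp, specProj_comp_specProj hσ hζ hp (hc i) (hc' i), if_neg hi]

/-- `colourProj c (colourProj c' x)` is `colourProj c x` or `0`. [folklore] -/
theorem colourProj_colourProj_apply (hσ : σ ^ p = 1) (hζ : IsPrimitiveRoot ζ p) (hp : 0 < p) {c c' : Fin r → ℕ}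
    (hc : ∀ i, c i < p) (hc' : ∀ i, c' i < p) (x : hodgeTensorSpaceOver K W r 0) :
    colourProj σ ζ p c (colourProj σ ζ p c' x) = if c = c' then colourProj σ ζ p c x else 0 := by
  rw [← Module.End.mul_apply, colourProj_mul hσ hζ hp hc hc']
  split_ifs <;> rfl

/-! ### §3 The block scalars act diagonally on the coloured components -/

omit [CharZero K] in
/-- **`g_λ^{⊗ r} = Σ_c (Π_i λ_{c i}) • colourProj c`.** [folklore] -/
theorem slotMap_blockScalar (lam : ℕ → K) :
    slotMap (fun _ : Fin r => blockScalar σ ζ p lam) =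
      ∑ c ∈ Fintype.piFinset (fun _ : Fin r => Finset.range p), (∏ i, lam (c i)) • colourProj σ ζ p c := by
  simp only [blockScalar_def]
  rw [slotMap_sum]
  refine Finset.sum_congr rfl fun c _ => ?_
  rw [slotMap_smul]
  rfl

/-- The coloured component of `g_λ^{⊗ r} x` is `(Π_i λ_{c i}) • x_c`. [folklore] -/
theorem colourProj_slotMap_blockScalar (hσ : σ ^ p = 1) (hζ : IsPrimitiveRoot ζ p) (hp : 0 < p) (lam : ℕ → K)
    {c : Fin r → ℕ} (hc : ∀ i, c i < p) (x : hodgeTensorSpaceOver K W r 0) :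
    colourProj σ ζ p c (slotMap (fun _ : Fin r => blockScalar σ ζ p lam) x) = (∏ i, lam (c i)) • colourProj σ ζ p c x := by
  rw [slotMap_blockScalar, LinearMap.sum_apply, map_sum]
  simp only [LinearMap.smul_apply, map_smul]
  rw [Finset.sum_eq_single_of_mem c (mem_colourings_iff.mpr hc)]
  · rw [colourProj_colourProj_apply hσ hζ hp hc hc, if_pos rfl]
  · intro c' hc' hne
    rw [colourProj_colourProj_apply hσ hζ hp hc (mem_colourings_iff.mp hc'), if_neg (Ne.symm hne), smul_zero]

/-- **If `g_λ^{⊗ r}` fixes `x` then `(Π_i λ_{c i}) • x_c = x_c` for every colouring `c`.** [folklore] -/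
theorem smul_colourProj_eq_of_fixed (hσ : σ ^ p = 1) (hζ : IsPrimitiveRoot ζ p) (hp : 0 < p) {lam : ℕ → K}
    {x : hodgeTensorSpaceOver K W r 0} (hfix : slotMap (fun _ : Fin r => blockScalar σ ζ p lam) x = x)
    {c : Fin r → ℕ} (hc : ∀ i, c i < p) :
    (∏ i, lam (c i)) • colourProj σ ζ p c x = colourProj σ ζ p c x := by
  rw [← colourProj_slotMap_blockScalar hσ hζ hp lam hc x, hfix]

/-- Conversely, `g_λ^{⊗ r}` fixes `x` as soon as `(Π_i λ_{c i}) • x_c = x_c` for every colouring. [folklore] -/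
theorem slotMap_blockScalar_eq_self_of_forall (hζ : IsPrimitiveRoot ζ p) (hp : 0 < p) {lam : ℕ → K}
    {x : hodgeTensorSpaceOver K W r 0}
    (h : ∀ c : Fin r → ℕ, (∀ i, c i < p) → (∏ i, lam (c i)) • colourProj σ ζ p c x = colourProj σ ζ p c x) :
    slotMap (fun _ : Fin r => blockScalar σ ζ p lam) x = x := by
  rw [slotMap_blockScalar, LinearMap.sum_apply]
  simp only [LinearMap.smul_apply]
  rw [Finset.sum_congr rfl fun c hc => h c (mem_colourings_iff.mp hc)]
  exact sum_colourProj_apply hζ hp x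

/-! ### §4 Automorphisms commuting with `σ` respect the coloured components -/

omit [CharZero K] in
/-- An endomorphism commuting with `σ` commutes, slotwise, with every colour projector. [folklore] -/
theorem slotMap_comm_colourProj (γ : Module.End K W) (hγ : γ * σ = σ * γ) (c : Fin r → ℕ) :
    slotMap (fun _ : Fin r => γ) * colourProj σ ζ p c = colourProj σ ζ p c * slotMap (fun _ : Fin r => γ) := by
  rw [colourProj_def, ← slotMap_mul, ← slotMap_mul]
  congr 1
  funext i
  exact commute_specProj γ hγ (c i)

omit [CharZero K] in
/-- `γ^{⊗ r} (x_c) = (γ^{⊗ r} x)_c` for `γ` commuting with `σ`. [folklore] -/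
theorem tensorSpaceActOver_colourProj {γ : W ≃ₗ[K] W} (hγ : ∀ x, γ (σ x) = σ (γ x)) (c : Fin r → ℕ)
    (x : hodgeTensorSpaceOver K W r 0) :
    tensorSpaceActOver γ (colourProj σ ζ p c x) = colourProj σ ζ p c (tensorSpaceActOver γ x) := by
  have hc : (γ : W →ₗ[K] W) * σ = σ * (γ : W →ₗ[K] W) := LinearMap.ext fun y => hγ y
  have h := LinearMap.congr_fun (slotMap_comm_colourProj (σ := σ) (ζ := ζ) (p := p) (γ : W →ₗ[K] W) hc c) x
  rw [Module.End.mul_apply, Module.End.mul_apply] at h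
  rw [tensorSpaceActOver_eq_slotMap_apply, tensorSpaceActOver_eq_slotMap_apply]
  exact h

omit [CharZero K] in
/-- If `γ` (commuting with `σ`) fixes `x`, it fixes every coloured component of `x`. [folklore] -/
theorem tensorSpaceActOver_colourProj_of_fixed {γ : W ≃ₗ[K] W} (hγ : ∀ x, γ (σ x) = σ (γ x))
    {x : hodgeTensorSpaceOver K W r 0} (hfix : tensorSpaceActOver γ x = x) (c : Fin r → ℕ) :
    tensorSpaceActOver γ (colourProj σ ζ p c x) = colourProj σ ζ p c x := by
  rw [tensorSpaceActOver_colourProj hγ, hfix]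

/-- If `γ` fixes every coloured component of `x` (colours `< p`), it fixes `x`. [folklore] -/
theorem tensorSpaceActOver_eq_self_of_forall_colourProj (hζ : IsPrimitiveRoot ζ p) (hp : 0 < p) (γ : W ≃ₗ[K] W)
    {x : hodgeTensorSpaceOver K W r 0}
    (h : ∀ c : Fin r → ℕ, (∀ i, c i < p) → tensorSpaceActOver γ (colourProj σ ζ p c x) = colourProj σ ζ p c x) :
    tensorSpaceActOver γ x = x := by
  conv_lhs => rw [← sum_colourProj_apply (σ := σ) hζ hp x]
  rw [map_sum, Finset.sum_congr rfl fun c hc => h c (mem_colourings_iff.mp hc)]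
  exact sum_colourProj_apply hζ hp x

end Colour

/-! ### §5 Colour counts and balanced colourings -/

/-- The colour count `d_j(c) = #{i : c i = j}`. [folklore] -/
def colourCount (c : Fin r → ℕ) (j : ℕ) : ℕ := (Finset.univ.filter fun i => c i = j).card

/-- Unfolding lemma. [folklore] -/
theorem colourCount_def (c : Fin r → ℕ) (j : ℕ) : colourCount c j = (Finset.univ.filter fun i => c i = j).card := rfl

/-- `Π_i λ_{c i} = Π_{j ∈ s} λ_j ^ d_j(c)` when the colours lie in `s`. [folklore] -/
theorem prod_eq_prod_pow_colourCount {M : Type*} [CommMonoid M] (lam : ℕ → M) (c : Fin r → ℕ) {s : Finset ℕ}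
    (hc : ∀ i, c i ∈ s) : ∏ i, lam (c i) = ∏ j ∈ s, lam j ^ colourCount c j := by
  rw [← Finset.prod_fiberwise_of_maps_to' (s := Finset.univ) (t := s) (g := c) (fun i _ => hc i) lam]
  refine Finset.prod_congr rfl fun j _ => ?_
  rw [Finset.prod_const, colourCount_def]

/-- `Σ_i F (c i) = Σ_{j ∈ s} d_j(c) • F j` when the colours lie in `s`. [folklore] -/
theorem sum_eq_sum_colourCount_smul {M : Type*} [AddCommMonoid M] (F : ℕ → M) (c : Fin r → ℕ) {s : Finset ℕ}
    (hc : ∀ i, c i ∈ s) : ∑ i, F (c i) = ∑ j ∈ s, colourCount c j • F j := by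
  rw [← Finset.sum_fiberwise_of_maps_to' (s := Finset.univ) (t := s) (g := c) (fun i _ => hc i) F]
  refine Finset.sum_congr rfl fun j _ => ?_
  rw [Finset.sum_const, colourCount_def]

/-- A colour which does not occur has count `0`. [folklore] -/
theorem colourCount_eq_zero_of_forall_ne {c : Fin r → ℕ} {j : ℕ} (h : ∀ i, c i ≠ j) : colourCount c j = 0 := by
  rw [colourCount_def, Finset.card_eq_zero, Finset.filter_eq_empty_iff]
  exact fun i _ => h i

/-- **A balanced colouring kills every character of the centre**: if `λ_0 = 1`, `λ_j λ_{p-j} = 1` (`0 < j < p`,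
`p` odd) and `d_j(c) = d_{p-j}(c)` for `0 < j < p`, then `Π_i λ_{c i} = 1`. [folklore] -/
theorem prod_eq_one_of_balanced {p : ℕ} (hp : 0 < p) (hodd : Odd p) (lam : ℕ → K) (hlam0 : lam 0 = 1)
    (hlam : ∀ j, 0 < j → j < p → lam j * lam (p - j) = 1) (c : Fin r → ℕ) (hc : ∀ i, c i < p)
    (hbal : ∀ j ∈ Finset.Ico 1 p, colourCount c j = colourCount c (p - j)) : ∏ i, lam (c i) = 1 := by
  rw [prod_eq_prod_pow_colourCount lam c (s := Finset.range p) (fun i => Finset.mem_range.mpr (hc i)),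
    Finset.range_eq_Ico, Finset.prod_eq_prod_Ico_succ_bot hp, hlam0, one_pow, one_mul]
  refine Finset.prod_involution (fun j _ => p - j) ?_ ?_ ?_ ?_
  · intro j hj
    have hj' := Finset.mem_Ico.mp hj
    rw [← hbal j hj, ← mul_pow, hlam j hj'.1 hj'.2, one_pow]
  · intro j hj _
    have hj' := Finset.mem_Ico.mp hj
    obtain ⟨m, rfl⟩ := hodd
    omega
  · intro j hj
    have hj' := Finset.mem_Ico.mp hj
    exact Finset.mem_Ico.mpr ⟨by omega, by omega⟩
  · intro j hj
    have hj' := Finset.mem_Ico.mp hj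
    exact Nat.sub_sub_self hj'.2.le

end Summit.HodgeConjecture.HodgeConjecture.Theorems.CyclicUnitaryPowersColourProjectors

end
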